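import Summits.CriticalPhenomena.SAWScalingLimit.Theorems.SAWTwistedSelfEnergyParaMartingaleDefs
import Literature.Probability.RandomPlanarGeometry.SAWExplorationFiltration
import HarnessLib

/-!
# Prefixes of a self-avoiding walk and the vanishing of the parafermionic observable after a bad past
(crux `SubseqIdentification`, stmt-CriticalPhenomena-0783; line `parafermionic-martingale`, helper of the
split piece S3b `stub_paraExplorationData` of the XL passage stub `stub_paraPassage`; stub-worker of the
lead c6)

Combinatorics of the pasts `γ[0,n] = prefixAt γ n` of a self-avoiding walk `γ` of the discrete domain
`Ω_δ` (`support_prefixAt`: the first `n + 1` vertices; nesting; a vertex of index `> i` is not on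
`γ[0,i]` when `i < |γ|`), and the key cancellation behind the exactness bookkeeping of the Doob
observable `Q_n = paraDoob`: if a past `γ[0,i]`, `i < |γ|`, contains the target `z`, or has a DEAD
STEP — a neighbour `u ∉ γ[0,i]` of its tip from which `z`, but not `b`, can be reached by a
self-avoiding walk of `Ω_δ` avoiding `γ[0,i]` (the excluded configuration of the one-step martingale
identity S1 of the line) — then at every later step `m > i` the continuation observable
`A(γ[0,m], z) = contObs` vanishes (`contObs_prefixAt_eq_zero`), hence `Q_m = 0`
(`paraDoob_eq_zero_of_bad`): a self-avoiding continuation from the tip `γ_m` to `z` avoiding `γ[0,m]`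
would end on the past in the first case, and in the second, followed backwards from `z` by the
`z`-alive walk from `u` and forwards from `γ_m` by the walk's own continuation to `b`, would make `u`
alive for `b`.

References: H. Duminil-Copin, S. Smirnov, Ann. of Math. 175 (2012), §2 (the parafermionic
observable: vertices from which the target is unreachable carry no term); G. F. Lawler, O. Schramm,
W. Werner, Proc. Sympos. Pure Math. 72 (2004), §3.4 (self-avoiding walks of a domain, the
exploration / domain Markov property).
-/

noncomputable section

open MeasureTheory Filter Topology Set
open scoped NNReal ENNReal Classical BigOperators
open Literature.Probability.LatticeModels
open Literature.Probability.RandomPlanarGeometry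
open UpperHalfPlane (upperHalfPlaneSet)

namespace Summit.CriticalPhenomena.SAWScalingLimit.Theorems.SubseqIdentification.ParaMartingale

open Summit.CriticalPhenomena.SAWScalingLimit.Theorems.SubseqIdentification.RoomEntropy
  (prefixAt capTimeOf)

/-! ## Prefix combinatorics of a self-avoiding walk -/

section Prefix

variable {Ω : Set ℂ} {δ : ℝ} {a b : Site 2}

/-- The support of the past `γ[0,n]` is the list of the first `n + 1` vertices. [folklore] -/
theorem support_prefixAt (γ : SAW.DomainSAW Ω δ a b) (n : ℕ) :
    (prefixAt γ n).support = γ.walk.support.take (n + 1) :=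
  SAW.support_takeUntil_getVert γ.isPath n

/-- Pasts are nested. [folklore] -/
theorem support_prefixAt_subset (γ : SAW.DomainSAW Ω δ a b) {i m : ℕ} (h : i ≤ m) :
    (prefixAt γ i).support ⊆ (prefixAt γ m).support := by
  rw [support_prefixAt, support_prefixAt]
  exact (List.take_prefix_take_left (by omega : i + 1 ≤ m + 1)).subset

/-- A vertex of index `> i` of a self-avoiding walk longer than `i` is not among its first
`i + 1` vertices. [folklore] -/
theorem getVert_notMem_support_prefixAt (γ : SAW.DomainSAW Ω δ a b) {i j : ℕ} (hij : i < j)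
    (hi : i < γ.walk.length) : γ.walk.getVert j ∉ (prefixAt γ i).support := by
  intro hmem
  rw [support_prefixAt, List.mem_iff_getElem] at hmem
  obtain ⟨k, hk, hkj⟩ := hmem
  rw [List.length_take] at hk
  have hkl : k ≤ γ.walk.length := by
    have := γ.walk.length_support
    omega
  rw [List.getElem_take, ← γ.walk.getVert_eq_support_getElem hkl] at hkj
  -- `getVert j = getVert (min j |γ|)`
  have hj' : γ.walk.getVert j = γ.walk.getVert (min j γ.walk.length) := by
    rcases le_total j γ.walk.length with h | h
    · rw [min_eq_left h]
    · rw [min_eq_right h, γ.walk.getVert_of_length_le h, γ.walk.getVert_length]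
  rw [hj'] at hkj
  have := γ.isPath.getVert_injOn (by exact hkl) (by exact min_le_right j γ.walk.length) hkj
  omega

end Prefix

/-! ## After a bad past the observable to `z` vanishes -/

/-- **After a bad past every continuation observable to `z` vanishes.** If the past `γ[0,i]`
(`i < |γ|`) contains `z`, or has a DEAD STEP (a neighbour `u ∉ γ[0,i]` of its tip from which `z`,
but not `b`, is reachable by a self-avoiding walk of `Ω_δ` avoiding `γ[0,i]`), then for every `m > i`
no self-avoiding walk from the tip `γ_m` to `z` avoids `γ[0,m]` after its start, so
`A(γ[0,m], z) = contObs … (γ[0,m]) z = 0`: in the first case the walk ends at `z ∈ γ[0,m]`; in the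
second, the continuation `γ[m, |γ|]` to `b` reversed through such a walk and the `z`-alive walk from
`u` would make `u` alive for `b`. [cite: DuminilCopinSmirnov2012, §2] -/
theorem contObs_prefixAt_eq_zero {D : DobrushinDomain} {δ : ℝ} {a a' b z : Site 2}
    (γ : SAW.DomainSAW D.carrier δ a b) {i m : ℕ} (him : i < m)
    (hi : i < γ.walk.length)
    (hbad : z ∈ (prefixAt γ i).support ∨
      ∃ v u : Site 2, (prefixAt γ i).support.getLast? = some v ∧
        (discreteDomainGraph D.carrier δ).Adj v u ∧ u ∉ (prefixAt γ i).support ∧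
        (∃ ω : SAW.DomainSAW D.carrier δ u z, ∀ y ∈ ω.walk.support, y ∉ (prefixAt γ i).support) ∧
        ¬ ∃ ω : SAW.DomainSAW D.carrier δ u b, ∀ y ∈ ω.walk.support, y ∉ (prefixAt γ i).support) :
    contObs D.carrier δ a' (prefixAt γ m) z = 0 := by
  -- every self-avoiding continuation from the tip `γ_m` to `z` meets the past `γ[0,m]` again
  suffices key : ∀ ω : SAW.DomainSAW D.carrier δ (γ.walk.getVert m) z,
      ¬ ∀ u ∈ ω.walk.support.tail, u ∉ (prefixAt γ m).support by
    unfold contObs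
    simp only [key, if_false, tsum_zero]
  intro ω hω
  have hsub : (prefixAt γ i).support ⊆ (prefixAt γ m).support := support_prefixAt_subset γ him.le
  rcases hbad with hz | ⟨-, u, -, -, -, ⟨ω₁, hω₁⟩, hdead⟩
  · -- `z` on the past: the tip is not `z`, so `z` is in the tail of `ω` and in the past
    have hne : γ.walk.getVert m ≠ z := fun h ↦ getVert_notMem_support_prefixAt γ him hi (h ▸ hz)
    exact hω z (ω.walk.end_mem_tail_support_of_ne hne) (hsub hz)
  · -- dead step: the `b`-alive continuation of `γ` reversed through `ω` resurrects it
    refine hdead ?_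
    set W := ω₁.walk.append (ω.walk.reverse.append (γ.walk.drop m)) with hW
    refine ⟨⟨W.bypass, W.bypass_isPath⟩, fun y hy ↦ ?_⟩
    have hy' : y ∈ W.support := W.support_bypass_subset_support hy
    rw [hW, SimpleGraph.Walk.mem_support_append_iff, SimpleGraph.Walk.mem_support_append_iff,
      SimpleGraph.Walk.support_reverse, List.mem_reverse] at hy'
    rcases hy' with h1 | h2 | h3
    · exact hω₁ y h1
    · rw [← ω.walk.cons_tail_support, List.mem_cons] at h2
      rcases h2 with rfl | h2
      · exact getVert_notMem_support_prefixAt γ him hi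
      · exact fun h ↦ hω y h2 (hsub h)
    · obtain ⟨n, hn, -⟩ := SimpleGraph.Walk.mem_support_iff_exists_getVert.1 h3
      rw [SimpleGraph.Walk.drop_getVert] at hn
      rw [← hn]
      exact getVert_notMem_support_prefixAt γ (by omega) hi

/-- The Doob-normalised observable vanishes at every step after a bad past. [folklore] -/
theorem paraDoob_eq_zero_of_bad {D : DobrushinDomain} {δ : ℝ} {a a' b z : Site 2}
    (γ : SAW.DomainSAW D.carrier δ a b) {i m : ℕ} (him : i < m)
    (hi : i < γ.walk.length)
    (hbad : z ∈ (prefixAt γ i).support ∨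
      ∃ v u : Site 2, (prefixAt γ i).support.getLast? = some v ∧
        (discreteDomainGraph D.carrier δ).Adj v u ∧ u ∉ (prefixAt γ i).support ∧
        (∃ ω : SAW.DomainSAW D.carrier δ u z, ∀ y ∈ ω.walk.support, y ∉ (prefixAt γ i).support) ∧
        ¬ ∃ ω : SAW.DomainSAW D.carrier δ u b, ∀ y ∈ ω.walk.support, y ∉ (prefixAt γ i).support) :
    paraDoob D δ a a' b z γ m = 0 := by
  simp only [paraDoob, pastObs, contObs_prefixAt_eq_zero γ him hi hbad, zero_div]

end Summit.CriticalPhenomena.SAWScalingLimit.Theorems.SubseqIdentification.ParaMartingale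

end
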